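import Literature.Topology.FourManifolds.RealProjectiveSpace
import Literature.Geometry.Manifold.QuotientManifold
import HarnessLib

/-!
# The standard real projective space `𝕊ⁿ/±1` (discharge of `exists_isRealProjectiveSpace`)

Sibling proof file of `RealProjectiveSpace.lean` (D-0014). Using the general theorem that the
orbit space of a free properly discontinuous `C^n` action is a `C^n` manifold with the projection
a `C^n` local diffeomorphism (`Literature/Geometry/Manifold/QuotientManifold.lean`, Mathlib's TODO
for `MulAction.instChartedSpaceQuotient`), we construct the standard real projective `n`-space:

* `Literature.RealProjectiveSpace n`: the orbit space of the antipodal action `Literature.antipodalAction n` of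
  `ℤˣ = {±1}` on the round sphere `𝕊ⁿ`, with Mathlib's quotient topology and quotient charted
  space structure; instances: Hausdorff, compact, second countable, `ChartedSpace (𝔼 n)`,
  `IsManifold (𝓡 n) ∞` (`±id` are smooth: `contMDiff_neg_sphere`);
* `Literature.Topology.FourManifolds.RealProjectiveSpace.mk`: the projection `𝕊ⁿ → ℝℙⁿ`, a `C^∞` local diffeomorphism
  identifying exactly antipodes (`Literature.Topology.FourManifolds.isRealProjectiveSpace_realProjectiveSpace`);
* `Literature.exists_isRealProjectiveSpace_holds : exists_isRealProjectiveSpace n` — discharge of the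
  named fact of `RealProjectiveSpace.lean`;
* `Literature.Topology.FourManifolds.IsRealProjectiveSpace.nonempty_diffeomorph`,
  `Literature.Topology.FourManifolds.isRealProjectiveSpace_iff_nonempty_diffeomorph`: **uniqueness** — every `X` satisfying the relational predicate `IsRealProjectiveSpace n X` is
  diffeomorphic to the standard `RealProjectiveSpace n` (the induced bijection is a bijective local
  diffeomorphism), so the predicate means exactly "`X ≅ ℝℙⁿ`".

Source: A. Kosinski, *Differential Manifolds* (1993), Ch. I (1.3) ("`Pⁿ` is obtained by
identifying antipodal points in `Sⁿ` … `{π(Uᵢ⁺), hᵢπ⁻¹}` is an atlas on `Pⁿ`"); A. Hatcher,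
*Algebraic Topology* (2002), Example 1.43.

Unrelated namesake: `Literature/NumberTheory/Transcendental/ProjectiveSpace.lean` charts the
algebraic projective space `ℙ 𝕜 (Fin (n + 1) → 𝕜)` on `Fin n → 𝕜` (no sphere, no Euclidean model);
it is not a model of `IsRealProjectiveSpace`, which is why the present type is needed.
-/

open scoped Manifold ContDiff Topology
open Set Function Metric

noncomputable section

namespace Literature.Topology.FourManifolds

/-- Local notation: `𝔼 n` is the model Euclidean space `EuclideanSpace ℝ (Fin n)`. -/
local notation "𝔼 " n:arg => EuclideanSpace ℝ (Fin n)

/-- Local notation: `𝕊 n` is the unit sphere in `EuclideanSpace ℝ (Fin (n + 1))`. -/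
local notation "𝕊 " n:arg => (Metric.sphere (0 : EuclideanSpace ℝ (Fin (n + 1))) 1)

attribute [local instance] antipodalAction

section Action

variable (n : ℕ)

/-- The antipodal action is by homeomorphisms (`±id`). [folklore] -/
theorem continuousConstSMul_antipodal : ContinuousConstSMul ℤˣ (𝕊 n) := by
  refine ⟨fun u => ?_⟩
  rcases Int.units_eq_one_or u with rfl | rfl
  · simp only [one_smul]
    exact continuous_id
  · simp only [antipodalAction_neg_one_smul]
    exact continuous_neg

/-- The antipodal action is free (`x ≠ -x` on the sphere) and by injections. [folklore] -/
theorem isCancelSMul_antipodal : IsCancelSMul ℤˣ (𝕊 n) := by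
  refine
    { left_cancel' := fun u x y h => ?_
      right_cancel' := fun u v x h => ?_ }
  · have h' := congrArg (fun z : 𝕊 n => u⁻¹ • z) h
    simpa only [inv_smul_smul] using h'
  · by_contra huv
    have hne : (u : ℤˣ) ≠ v := huv
    -- then `u = -v`, so `x = -x` on the sphere: impossible
    have huv' : u = -v := by
      rcases Int.units_eq_one_or u with rfl | rfl <;>
        rcases Int.units_eq_one_or v with rfl | rfl <;> first | exact absurd rfl hne | decide
    subst huv'
    have hx : -x = x := by
      have : (-v) • x = -(v • x) := by
        apply Subtype.ext
        rw [antipodalAction_smul_coe, coe_neg_sphere, antipodalAction_smul_coe]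
        simp [neg_smul]
      rw [this] at h
      -- `-(v • x) = v • x`; apply `v⁻¹ •`
      have h2 := congrArg (fun z : 𝕊 n => v⁻¹ • z) h
      simp only [inv_smul_smul] at h2
      rcases Int.units_eq_one_or v with rfl | rfl
      · simpa using h2
      · simp only [inv_neg, inv_one, antipodalAction_neg_one_smul, neg_neg] at h2
        exact h2
    exact (ne_neg_of_mem_unit_sphere ℝ x).symm hx

attribute [local instance] continuousConstSMul_antipodal isCancelSMul_antipodal

/-- The maps `±id` of the round sphere are smooth (`contMDiff_neg_sphere`). [folklore] -/
theorem contMDiff_antipodal_smul (u : ℤˣ) : ContMDiff (𝓡 n) (𝓡 n) ∞ (fun x : 𝕊 n => u • x) := by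
  haveI : Fact (Module.finrank ℝ (𝔼 (n + 1)) = n + 1) := ⟨finrank_euclideanSpace_fin⟩
  rcases Int.units_eq_one_or u with rfl | rfl
  · simp only [one_smul]
    exact contMDiff_id
  · simp only [antipodalAction_neg_one_smul]
    exact contMDiff_neg_sphere

end Action

attribute [local instance] continuousConstSMul_antipodal isCancelSMul_antipodal

/-! ### The standard real projective space -/

/-- **The standard real projective `n`-space** `ℝℙⁿ = 𝕊ⁿ/±1`: the orbit space of the antipodal
action of `{±1}` on the round sphere (Kosinski, *Differential Manifolds*, I.(1.3); Hatcher,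
*Algebraic Topology*, Example 1.43), as Mathlib's `MulAction.orbitRel.Quotient`. [folklore] -/
def RealProjectiveSpace (n : ℕ) : Type := MulAction.orbitRel.Quotient ℤˣ (𝕊 n)

namespace RealProjectiveSpace

variable (n : ℕ)

/-- The quotient topology on `ℝℙⁿ` (Mathlib's, transported to the synonym). [folklore] -/
instance instTopologicalSpace : TopologicalSpace (RealProjectiveSpace n) :=
  inferInstanceAs (TopologicalSpace (MulAction.orbitRel.Quotient ℤˣ (𝕊 n)))

/-- `ℝℙⁿ` is Hausdorff (quotient by a properly discontinuous action of a Hausdorff locally compact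
space; Mathlib's `t2Space_of_properlyDiscontinuousSMul_of_t2Space`). [folklore] -/
instance instT2Space : T2Space (RealProjectiveSpace n) :=
  inferInstanceAs (T2Space (MulAction.orbitRel.Quotient ℤˣ (𝕊 n)))

/-- `ℝℙⁿ` is compact (quotient of the compact sphere). [folklore] -/
instance instCompactSpace : CompactSpace (RealProjectiveSpace n) :=
  inferInstanceAs (CompactSpace (Quotient (MulAction.orbitRel ℤˣ (𝕊 n))))

/-- `ℝℙⁿ` is second countable (open quotient of the second countable sphere; Mathlib's
`ContinuousConstSMul.secondCountableTopology`). [folklore] -/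
instance instSecondCountableTopology : SecondCountableTopology (RealProjectiveSpace n) :=
  ContinuousConstSMul.secondCountableTopology (Γ := ℤˣ) (T := 𝕊 n)

/-- The charted space structure of `ℝℙⁿ` on `ℝⁿ`: Mathlib's `MulAction.instChartedSpaceQuotient`
(charts `(local inverse of the projection) ≫ (chart of 𝕊ⁿ)`, i.e. Kosinski's atlas
`{π(Uᵢ⁺), hᵢπ⁻¹}`, I.(1.3)). [folklore] -/
instance instChartedSpace : ChartedSpace (𝔼 n) (RealProjectiveSpace n) :=
  inferInstanceAs (ChartedSpace (𝔼 n) (MulAction.orbitRel.Quotient ℤˣ (𝕊 n)))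

/-- **`ℝℙⁿ` is a smooth (`C^∞`) manifold**: the chart transitions are those of `𝕊ⁿ` composed with
`±id` (`Literature.Geometry.Manifold.QuotientManifold.isManifold`; Kosinski I.(1.3)). [folklore] -/
instance instIsManifold : IsManifold (𝓡 n) ∞ (RealProjectiveSpace n) :=
  Literature.Geometry.Manifold.QuotientManifold.isManifold (I := 𝓡 n) (n := ∞) (G := ℤˣ) (M := 𝕊 n)
    (contMDiff_antipodal_smul n)

/-- The projection `𝕊ⁿ → ℝℙⁿ`. [folklore] -/
def mk : (𝕊 n) → RealProjectiveSpace n := Literature.Geometry.Manifold.QuotientManifold.mk (G := ℤˣ)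

/-- Two points of the sphere have the same image in `ℝℙⁿ` iff they are equal or antipodal.
[folklore] -/
theorem mk_eq_mk_iff {n : ℕ} (x y : 𝕊 n) : mk n x = mk n y ↔ y = x ∨ y = -x := by
  refine (Literature.Geometry.Manifold.QuotientManifold.mk_eq_mk_iff (G := ℤˣ) (M := 𝕊 n) (x := x) (y := y)).trans ?_
  constructor
  · rintro ⟨u, rfl⟩
    rcases Int.units_eq_one_or u with rfl | rfl
    · exact Or.inl (one_smul _ _).symm
    · right
      rw [antipodalAction_neg_one_smul, neg_neg]
  · rintro (rfl | rfl)
    · exact ⟨1, one_smul _ _⟩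
    · exact ⟨-1, by rw [antipodalAction_neg_one_smul, neg_neg]⟩

/-- The projection `𝕊ⁿ → ℝℙⁿ` is surjective. [folklore] -/
theorem mk_surjective : Surjective (mk n) := Quotient.mk_surjective

/-- **The projection `𝕊ⁿ → ℝℙⁿ` is a `C^∞` local diffeomorphism**
(`Literature.Geometry.Manifold.QuotientManifold.isLocalDiffeomorph_mk`; Kosinski I.(1.3): `π` is a diffeomorphism on
each `Uᵢ⁺`). [folklore] -/
theorem isLocalDiffeomorph_mk : IsLocalDiffeomorph (𝓡 n) (𝓡 n) ∞ (mk n) :=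
  Literature.Geometry.Manifold.QuotientManifold.isLocalDiffeomorph_mk (I := 𝓡 n) (n := ∞) (G := ℤˣ) (M := 𝕊 n)
    (contMDiff_antipodal_smul n)

/-- The projection `𝕊ⁿ → ℝℙⁿ` is `C^∞`. [folklore] -/
theorem contMDiff_mk : ContMDiff (𝓡 n) (𝓡 n) ∞ (mk n) :=
  (isLocalDiffeomorph_mk n).contMDiff

end RealProjectiveSpace

/-- **The standard `ℝℙⁿ` is a real projective `n`-space** in the sense of the relational predicate
`IsRealProjectiveSpace`: its projection is a `C^∞` local diffeomorphism of `𝕊ⁿ` onto it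
identifying exactly antipodal points (Kosinski, *Differential Manifolds*, I.(1.3)). [folklore] -/
theorem isRealProjectiveSpace_realProjectiveSpace (n : ℕ) :
    IsRealProjectiveSpace n (RealProjectiveSpace n) :=
  ⟨RealProjectiveSpace.mk n, RealProjectiveSpace.isLocalDiffeomorph_mk n,
    RealProjectiveSpace.mk_surjective n, RealProjectiveSpace.mk_eq_mk_iff⟩

/-- **Discharge of the named fact `exists_isRealProjectiveSpace`** (`RealProjectiveSpace.lean`):
for every `n` the standard `ℝℙⁿ = 𝕊ⁿ/±1` is a Hausdorff, second countable, compact `C^∞`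
`n`-manifold which is a real projective `n`-space (Kosinski, *Differential Manifolds* (1993),
Ch. I (1.3); Hatcher, *Algebraic Topology*, Example 1.43). [cite: Kosinski1993, Ch. I (1.3)] -/
theorem exists_isRealProjectiveSpace_holds (n : ℕ) : exists_isRealProjectiveSpace n :=
  ⟨RealProjectiveSpace n, inferInstance, inferInstance, inferInstance, inferInstance, inferInstance,
    inferInstance, isRealProjectiveSpace_realProjectiveSpace n⟩

/-! ### Uniqueness: every real projective `n`-space is diffeomorphic to the standard one -/

section Unique

variable {n : ℕ} {X : Type*} [TopologicalSpace X] [ChartedSpace (𝔼 n) X]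

/-- **The relational predicate pins down `ℝℙⁿ` up to diffeomorphism.** If `q : 𝕊ⁿ → X` is a
`C^∞` local diffeomorphism onto `X` identifying exactly antipodes (`IsRealProjectiveSpace n X`),
then the induced bijection `X → ℝℙⁿ`, `q x ↦ [x]`, is a diffeomorphism onto the standard
`RealProjectiveSpace n`: near `q x` it is `mk ∘ q⁻¹` for a local inverse `q⁻¹` of `q`, a
composite of local diffeomorphisms, and a bijective local diffeomorphism is a diffeomorphism
(`IsLocalDiffeomorph.diffeomorphOfBijective`) (Kosinski, *Differential Manifolds*, I.(1.3): the
smooth structure on `Pⁿ` is the one with the atlas `{π(Uᵢ⁺), hᵢπ⁻¹}`). [folklore] -/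
theorem IsRealProjectiveSpace.nonempty_diffeomorph (h : IsRealProjectiveSpace n X) :
    Nonempty (X ≃ₘ⟮𝓡 n, 𝓡 n⟯ RealProjectiveSpace n) := by
  obtain ⟨q, hq, hsurj, hfib⟩ := h
  -- a set-theoretic section of `q` and the induced map `f = mk ∘ r`
  set r : X → 𝕊 n := surjInv hsurj with hr_def
  have hqr : ∀ y, q (r y) = y := surjInv_eq hsurj
  set f : X → RealProjectiveSpace n := fun y => RealProjectiveSpace.mk n (r y) with hf_def
  -- `f (q x) = mk x`
  have hfq : ∀ x, f (q x) = RealProjectiveSpace.mk n x := by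
    intro x
    show RealProjectiveSpace.mk n (r (q x)) = RealProjectiveSpace.mk n x
    rw [RealProjectiveSpace.mk_eq_mk_iff]
    exact (hfib (r (q x)) x).1 (hqr (q x))
  have hbij : Bijective f := by
    constructor
    · intro y₁ y₂ hy
      obtain ⟨x₁, rfl⟩ := hsurj y₁
      obtain ⟨x₂, rfl⟩ := hsurj y₂
      rw [hfq, hfq, RealProjectiveSpace.mk_eq_mk_iff] at hy
      exact (hfib x₁ x₂).2 hy
    · intro z
      obtain ⟨x, rfl⟩ := RealProjectiveSpace.mk_surjective n z
      exact ⟨q x, hfq x⟩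
  have hloc : IsLocalDiffeomorph (𝓡 n) (𝓡 n) ∞ f := by
    intro y
    obtain ⟨x, rfl⟩ := hsurj y
    obtain ⟨Φ, hxΦ, hqΦ⟩ := hq x
    obtain ⟨Ψ, hxΨ, hπΨ⟩ := RealProjectiveSpace.isLocalDiffeomorph_mk n x
    refine ⟨Φ.symm.trans Ψ, ?_, ?_⟩
    · -- `q x ∈ (Φ.symm.trans Ψ).source`
      have hΦx : Φ.toPartialEquiv x = q x := (hqΦ hxΦ).symm
      show q x ∈ Φ.target ∩ Φ.toPartialEquiv.symm ⁻¹' Ψ.source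
      refine ⟨hΦx ▸ Φ.toPartialEquiv.map_source hxΦ, ?_⟩
      rw [mem_preimage, ← hΦx, Φ.toPartialEquiv.left_inv hxΦ]
      exact hxΨ
    · -- `f = Ψ ∘ Φ.symm = mk ∘ Φ.symm` on the source
      intro y' hy'
      obtain ⟨hy'1, hy'2⟩ := hy'
      have hy't : y' ∈ Φ.target := hy'1
      have hy'Ψ : Φ.toPartialEquiv.symm y' ∈ Ψ.source := hy'2
      have hs : Φ.toPartialEquiv.symm y' ∈ Φ.source := Φ.toPartialEquiv.map_target hy't
      have hqy' : q (Φ.toPartialEquiv.symm y') = y' := by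
        rw [hqΦ hs]
        exact Φ.toPartialEquiv.right_inv hy't
      show f y' = Ψ.toPartialEquiv (Φ.toPartialEquiv.symm y')
      rw [← hπΨ hy'Ψ]
      conv_lhs => rw [← hqy']
      exact hfq _
  exact ⟨hloc.diffeomorphOfBijective hbij⟩

/-- **Characterisation of the relational predicate**: a charted space `X` on `ℝⁿ` is a real
projective `n`-space iff it is diffeomorphic to the standard `RealProjectiveSpace n` (for the
converse, compose the standard projection with the diffeomorphism). [folklore] -/
theorem isRealProjectiveSpace_iff_nonempty_diffeomorph :
    IsRealProjectiveSpace n X ↔ Nonempty (X ≃ₘ⟮𝓡 n, 𝓡 n⟯ RealProjectiveSpace n) :=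
  ⟨IsRealProjectiveSpace.nonempty_diffeomorph, fun ⟨e⟩ =>
    (isRealProjectiveSpace_realProjectiveSpace n).of_diffeomorph e.symm⟩

/-- Any two real projective `n`-spaces are diffeomorphic. [folklore] -/
theorem IsRealProjectiveSpace.nonempty_diffeomorph_of_isRealProjectiveSpace
    (h : IsRealProjectiveSpace n X) {Y : Type*} [TopologicalSpace Y] [ChartedSpace (𝔼 n) Y]
    (h' : IsRealProjectiveSpace n Y) : Nonempty (X ≃ₘ⟮𝓡 n, 𝓡 n⟯ Y) := by
  obtain ⟨e⟩ := h.nonempty_diffeomorph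
  obtain ⟨e'⟩ := h'.nonempty_diffeomorph
  exact ⟨e.trans e'.symm⟩

end Unique

end Literature.Topology.FourManifolds
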